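import Mathlib
import Literature.AlgebraicGeometry.Resolution.CobordantVertexChart
import Summits.ResolutionOfSingularities.ResolutionOfSingularities.Theorems.WeightedInvariantLocalWeightedDropSpaceCountGame

/-!
# `LocalWeightedDrop`, the NC count game — TOT2-LINE piece S-SET (1/3): **RESOLUTION SETTINGS (DECORATIONS) — DEFINITIONS**

[OURS · L1 W4.3 · chain w43, engine crux `LocalWeightedDrop` stmt-ResolutionOfSingularities-8899; sub-line under the v32 registered stub
`stub_spaceNCRankDrop` (positional embedded normal-crossings resolution of surface germs, ordinal form), design memo
`L/res-L1-w43-lead-1/g4/TOT2-LINE.md` v1 §2 (res-L1-w43-lead-1), piece S-SET = res-L1-w43-stub-1, with the two RESHAPES announced on STATUS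
11:31:43Z.  MODEL: the «resolution settings» / boundary-with-history (B, O) of Cossart–Jannsen–Saito, LNM 2270 (2020) §3 (Def. 3.5/3.6/3.11/3.15)
and Hauser–Perlega, Publ. RIMS 60 (2024) §2 / Perlega arXiv:2011.14443 §7.1, transcribed to the programme's OWN count game
(`TameFourTupleDrop.IsCountMove` / `MoveClause`, positions = germs `b ∈ k⟦x₀,…,x_m⟧`); nothing here is a statement of any manuscript.
All definitions are dimension-generic (`Fin (m + 1)` variables); the line uses `m = 2`.]

THE DESIGN (why it is this light).  A DECORATION of a position `b` is `δ = (f, E, O)`: an equation `f` of the strict transform, a BOUNDARY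
`E ⊆ Fin (m+1)` — a set of COORDINATE HYPERPLANES `X l` OF THE POSITION'S OWN COORDINATES — and its OLD part `O ⊆ E` (CJS's history function).
Boundary components can be taken to be coordinate hyperplanes because every B-permissible move straightens the boundary ((P3) below), so that
after ANY move the through-going strict transforms of the boundary are literally coordinates `y_l` of the new position and the new exceptional
divisor is `s = X 0`; at the start `E = ∅`.  Units never matter: admissibility is RADICAL EQUIVALENCE (A1).  Consequently CJS's «`E` is a simple
normal crossings divisor» and «`E'` is again one» are automatic, and «a boundary component does not divide the strict transform» is elementary.

* `Decoration k m` — `(f, E, O, O ⊆ E)`; `Decoration.total δ = f · ∏_{l ∈ E} X l`; `Decoration.o δ = ord f` (as `ℕ`), `Decoration.c δ = o + |O|`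
  (Hauser–Perlega's `c`; CJS's `H^O ↔ (o, |O|)`), `Decoration.head δ = (o, c)` in `ℕ ×ₗ ℕ`.
* `Admissible b δ` — (A1) `b` and `total δ` divide powers of each other; (A2) `f` squarefree; (A3) no boundary letter divides `f`.
* `IsBPermissible δ Φ w` — a legal count move `(Φ, w)` (centre `C = V(X_i : w_i = 1)` in the coordinates `Φ` introduces: `x^old = Φ(x^new)`)
  which is (P1) PERMISSIBLE = equimultiple along `C`: `f∘Φ ∈ 𝔭_C^{ord f}`, stated as `ord (f∘Φ) ≤ weightedOrder_w (f∘Φ)`; (P2) O-PERMISSIBLE: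
  `C ⊆` every old component, i.e. `Φ_l ∈ 𝔭_C`; (P3) NORMAL CROSSING WITH `E`: `Φ` straightens every boundary component, `Φ_l = u · X_{l'}`.
* THE TRANSFORM `Decoration.transform δ Φ w c i` at an answer (exceptional point `c`, live slot `i`) — total, by classical choice where needed:
  `f' :=` the sliced `s`-saturated strict transform `g` of `f` IF `g` is squarefree, ELSE a squarefree element radical-equivalent to `g`
  (then `ord f' < ord g ≤ ord f`: a non-reduced strict transform is a HEAD DROP, so inside every «fundamental unit» `f'` IS the actual strict
  transform — lead-1's (Q4) — and no reducedness theorem for strict transforms is owed); `E' := {0} ∪ {new index of l' : l ∈ E, Φ_l = u·X_{l'},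
  c_{l'} = 0}` (the new exceptional letter `s = X 0` and the through-going boundary letters, re-indexed by the slice); `O' :=` CJS's history rule (3.6):
  all of `E'` if the order dropped (`o' < o`), else the through-going old letters `O'_inh` (so `|O'| ≤ |O|` and the head `(o, c)` never rises).
* choice functions with their specifications: `satExp`/`satPart` (the `s`-saturation `F = s^A · G`, `s ∤ G`, via
  `CobordantVertexChart.exists_eq_X_pow_mul_not_dvd`), `strIdx` (the letter `l'` of (P3)), `sqfRep` (the squarefree representative).
The lemmas (S1) admissibility of the transform, (S3) `o' ≤ o`, (S4) head non-increase, the start decoration and the NC recognitions are in the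
sequels `…NCResSettingTransform` / `…NCResSettingStart` (kernel lane).
-/

set_option linter.dupNamespace false -- mandated namespace of this single-conjunct summit

noncomputable section

namespace Summit.ResolutionOfSingularities.ResolutionOfSingularities.Theorems

namespace TameFourTupleDrop

open MvPowerSeries Literature.AlgebraicGeometry.Resolution

variable {k : Type} [Field k] {m : ℕ}

/-! ## Decorations and their head invariant -/

variable (k m) in
/-- A DECORATION (resolution setting at the point) of a position of the NC count game in `m + 1` variables: an equation `f` of the strict
transform, the boundary `E` = a set of coordinate letters (the boundary components are the coordinate hyperplanes `X l`, `l ∈ E`, of the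
position's own coordinates), and its old part `O ⊆ E` (Cossart–Jannsen–Saito's history function). [OURS · programme's count game] -/
structure Decoration where
  /-- an equation of the strict transform -/
  f : MvPowerSeries (Fin (m + 1)) k
  /-- the boundary letters: the boundary components are the coordinate hyperplanes `X l`, `l ∈ E` -/
  E : Finset (Fin (m + 1))
  /-- the OLD boundary letters (the history) -/
  O : Finset (Fin (m + 1))
  /-- old letters are boundary letters -/
  O_subset : O ⊆ E

namespace Decoration

/-- The reduced total equation `f · ∏_{l ∈ E} X l` of a decoration (strict transform times boundary, all with exponent one). -/
def total (δ : Decoration k m) : MvPowerSeries (Fin (m + 1)) k := δ.f * ∏ l ∈ δ.E, X l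

/-- The order `o = ord f` as a natural number (`0` is the junk value at `f = 0`, excluded by admissibility). -/
def o (δ : Decoration k m) : ℕ := (δ.f.order).toNat

/-- Hauser–Perlega's `c = o + (number of old components through the point)` (`= ord (f · ∏_{l ∈ O} X l)`); CJS's `H^O ↔ (o, |O|)`. -/
def c (δ : Decoration k m) : ℕ := δ.o + δ.O.card

/-- The HEAD INVARIANT `(o, c)` with the lexicographic order. -/
def head (δ : Decoration k m) : ℕ ×ₗ ℕ := toLex (δ.o, δ.c)

end Decoration

/-! ## Admissibility and B-permissible moves -/

/-- `Admissible b δ`: the decoration `δ = (f, E, O)` FITS the position `b`: (A1) RADICAL EQUIVALENCE — `b` and the reduced total equation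
`f · ∏_{l∈E} X l` divide powers of each other (units and multiplicities are immaterial for `GermIsNC`); (A2) `f` is SQUAREFREE (the strict
transform is a reduced hypersurface germ; in particular `f ≠ 0`); (A3) no boundary letter divides `f` (`X ⊄ B`). [OURS] -/
def Admissible (b : MvPowerSeries (Fin (m + 1)) k) (δ : Decoration k m) : Prop :=
  (∃ M N : ℕ, b ∣ δ.total ^ (M + 1) ∧ δ.total ∣ b ^ (N + 1)) ∧ Squarefree δ.f ∧ ∀ l ∈ δ.E, ¬ (X l ∣ δ.f)

/-- `IsBPermissible δ Φ w`: the count move `(Φ, w)` — a legal coordinate change `x^old = Φ(x^new)` and weights `w ∈ {0,1}^{m+1} ∖ 0`, centre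
`C = V(X_i : w_i = 1)` in the new coordinates, `𝔭_C` its ideal — is B-PERMISSIBLE for the decoration `δ = (f, E, O)` (CJS Def. 3.5/3.11,
hypersurface form): (P1) PERMISSIBLE — `C` lies in the equimultiple locus of `f`: `f∘Φ ∈ 𝔭_C^{ord f}`, i.e. `ord (f∘Φ) ≤ weightedOrder_w (f∘Φ)`
(the weight of a monomial for `w ∈ {0,1}^{m+1}` is its degree in the letters of `C`; automatic for the point centre `w ≡ 1`); (P2) O-PERMISSIBLE —
`C` lies inside every old boundary component: `Φ_l ∈ 𝔭_C` for `l ∈ O`; (P3) NORMAL CROSSING WITH THE BOUNDARY — `Φ` straightens every boundary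
component: `Φ_l = u · X_{l'}` with `u(0) ≠ 0`, so that centre and boundary are coordinate subspaces of one coordinate system. [OURS] -/
def IsBPermissible (δ : Decoration k m) (Φ : Fin (m + 1) → MvPowerSeries (Fin (m + 1)) k) (w : Fin (m + 1) → ℕ) : Prop :=
  IsCountMove Φ w ∧
    (subst Φ δ.f).order ≤ (subst Φ δ.f).weightedOrder w ∧
    (∀ l ∈ δ.O, (1 : ℕ∞) ≤ (Φ l).weightedOrder w) ∧
    (∀ l ∈ δ.E, ∃ (l' : Fin (m + 1)) (u : MvPowerSeries (Fin (m + 1)) k), constantCoeff u ≠ 0 ∧ Φ l = u * X l')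

/-! ## Choice functions: `s`-saturation, straightened letters, squarefree representatives -/

open Classical in
/-- The exponent `A` of the `s`-SATURATION `F = s^A · G`, `s ∤ G` (`s = X 0`) of a non-zero series (`0` at `F = 0`). -/
def satExp {n : ℕ} (F : MvPowerSeries (Fin (n + 1)) k) : ℕ :=
  if hF : F ≠ 0 then Classical.choose (CobordantVertexChart.exists_eq_X_pow_mul_not_dvd hF) else 0

open Classical in
/-- The `s`-free part `G` of the `s`-SATURATION `F = s^A · G`, `s ∤ G` of a non-zero series (`0` at `F = 0`). -/
def satPart {n : ℕ} (F : MvPowerSeries (Fin (n + 1)) k) : MvPowerSeries (Fin (n + 1)) k :=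
  if hF : F ≠ 0 then Classical.choose (Classical.choose_spec (CobordantVertexChart.exists_eq_X_pow_mul_not_dvd hF)) else 0

open Classical in
/-- Specification of the `s`-saturation. -/
theorem satExp_satPart_spec {n : ℕ} {F : MvPowerSeries (Fin (n + 1)) k} (hF : F ≠ 0) :
    F = X 0 ^ satExp F * satPart F ∧ ¬ (X 0 ∣ satPart F) := by
  rw [satExp, satPart, dif_pos hF, dif_pos hF]
  exact Classical.choose_spec (Classical.choose_spec (CobordantVertexChart.exists_eq_X_pow_mul_not_dvd hF))

open Classical in
/-- The STRAIGHTENED LETTER of `Φ_l`: the `l'` with `Φ_l = u · X_{l'}`, `u(0) ≠ 0`, when there is one (junk value `l` otherwise). -/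
def strIdx (Φ : Fin (m + 1) → MvPowerSeries (Fin (m + 1)) k) (l : Fin (m + 1)) : Fin (m + 1) :=
  if h : ∃ (l' : Fin (m + 1)) (u : MvPowerSeries (Fin (m + 1)) k), constantCoeff u ≠ 0 ∧ Φ l = u * X l' then Classical.choose h else l

/-- Specification of the straightened letter. -/
theorem strIdx_spec {Φ : Fin (m + 1) → MvPowerSeries (Fin (m + 1)) k} {l : Fin (m + 1)}
    (h : ∃ (l' : Fin (m + 1)) (u : MvPowerSeries (Fin (m + 1)) k), constantCoeff u ≠ 0 ∧ Φ l = u * X l') :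
    ∃ u : MvPowerSeries (Fin (m + 1)) k, constantCoeff u ≠ 0 ∧ Φ l = u * X (strIdx Φ l) := by
  classical
  rw [strIdx, dif_pos h]
  exact Classical.choose_spec h

open Classical in
/-- A SQUAREFREE REPRESENTATIVE of the radical class of `g`: `g` itself if `g` is squarefree, else some squarefree `r` with `r ∣ g ∣ r^(N+1)`
when one exists (junk value `g` otherwise — over a field one always exists, see the sequel). -/
def sqfRep {n : ℕ} (g : MvPowerSeries (Fin n) k) : MvPowerSeries (Fin n) k :=
  if Squarefree g then g
  else if h : ∃ r : MvPowerSeries (Fin n) k, Squarefree r ∧ r ∣ g ∧ ∃ N : ℕ, g ∣ r ^ (N + 1) then Classical.choose h else g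

/-- On squarefree input the representative is the input. -/
theorem sqfRep_of_squarefree {n : ℕ} {g : MvPowerSeries (Fin n) k} (hg : Squarefree g) : sqfRep g = g := by
  classical
  rw [sqfRep, if_pos hg]

/-- Specification of the squarefree representative when the input is not squarefree but has one. -/
theorem sqfRep_spec {n : ℕ} {g : MvPowerSeries (Fin n) k} (hg : ¬ Squarefree g)
    (h : ∃ r : MvPowerSeries (Fin n) k, Squarefree r ∧ r ∣ g ∧ ∃ N : ℕ, g ∣ r ^ (N + 1)) :
    Squarefree (sqfRep g) ∧ sqfRep g ∣ g ∧ ∃ N : ℕ, g ∣ sqfRep g ^ (N + 1) := by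
  classical
  rw [sqfRep, if_neg hg, dif_pos h]
  exact Classical.choose_spec h

/-! ## The transform of a decoration at an answer -/

namespace Decoration

/-- The chart transform `(f∘Φ)(chart_{w,c})` of the strict-transform equation (a series in `s = X 0` and `y_j = X j.succ`). -/
def fChart (δ : Decoration k m) (Φ : Fin (m + 1) → MvPowerSeries (Fin (m + 1)) k) (w : Fin (m + 1) → ℕ) (c : Fin (m + 1) → k) :
    MvPowerSeries (Fin (m + 1 + 1)) k :=
  subst (CobordantChart.chart w c) (subst Φ δ.f)

/-- The SLICED STRICT TRANSFORM `g = G|_{y_i = 0}` of `f` at the answer `(c, i)`: the `s`-free part of the chart transform, sliced at the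
live slot `i`. -/
def strict (δ : Decoration k m) (Φ : Fin (m + 1) → MvPowerSeries (Fin (m + 1)) k) (w : Fin (m + 1) → ℕ) (c : Fin (m + 1) → k)
    (i : Fin (m + 1)) : MvPowerSeries (Fin (m + 1)) k :=
  TupleGame.slice i (satPart (δ.fChart Φ w c))

open Classical in
/-- The NEW BOUNDARY LETTERS at the answer `(c, i)`: the new exceptional letter `0` (`s = X 0`) and, for each boundary letter `l` whose
component `Φ_l = u · X_{l'}` passes through the new point (`c_{l'} = 0`), the letter of `y_{l'}` after the slice (`Fin.predAbove i l'.succ`). -/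
def newLetters (S : Finset (Fin (m + 1))) (Φ : Fin (m + 1) → MvPowerSeries (Fin (m + 1)) k) (c : Fin (m + 1) → k) (i : Fin (m + 1)) :
    Finset (Fin (m + 1)) :=
  (S.filter fun l => c (strIdx Φ l) = 0).image fun l => Fin.predAbove i (Fin.succ (strIdx Φ l))

/-- Monotonicity of the new letters in the old ones. -/
theorem newLetters_mono {S T : Finset (Fin (m + 1))} (h : S ⊆ T) (Φ : Fin (m + 1) → MvPowerSeries (Fin (m + 1)) k)
    (c : Fin (m + 1) → k) (i : Fin (m + 1)) : newLetters S Φ c i ⊆ newLetters T Φ c i := by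
  classical
  unfold newLetters
  exact Finset.image_subset_image (Finset.filter_subset_filter _ h)

open Classical in
/-- THE TRANSFORM OF A DECORATION at the answer `(c, i)` of the move `(Φ, w)` (CJS Def. 3.6 + (3.6)/Def. 3.15 — the complete transform of
the boundary with history — in the count game; total by classical choice): `f'` = the sliced strict transform if squarefree, else a squarefree
representative of its radical class; `E'` = `{s} ∪` through-going boundary letters; `O'` = the through-going old letters if the order did
not drop (`o' = o`), and ALL of `E'` if it dropped (CJS (3.6): `O'(x') = B'(x')` when `H_{X'}(x') < H_X(x)`). -/
def transform (δ : Decoration k m) (Φ : Fin (m + 1) → MvPowerSeries (Fin (m + 1)) k) (w : Fin (m + 1) → ℕ) (c : Fin (m + 1) → k)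
    (i : Fin (m + 1)) : Decoration k m :=
  if ((sqfRep (δ.strict Φ w c i)).order).toNat < δ.o then
    { f := sqfRep (δ.strict Φ w c i), E := insert 0 (newLetters δ.E Φ c i), O := insert 0 (newLetters δ.E Φ c i),
      O_subset := le_rfl }
  else
    { f := sqfRep (δ.strict Φ w c i), E := insert 0 (newLetters δ.E Φ c i), O := newLetters δ.O Φ c i,
      O_subset := (newLetters_mono δ.O_subset Φ c i).trans (Finset.subset_insert _ _) }

/-- The equation of the transform. -/
theorem transform_f (δ : Decoration k m) (Φ : Fin (m + 1) → MvPowerSeries (Fin (m + 1)) k) (w : Fin (m + 1) → ℕ)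
    (c : Fin (m + 1) → k) (i : Fin (m + 1)) : (δ.transform Φ w c i).f = sqfRep (δ.strict Φ w c i) := by
  unfold transform
  split_ifs <;> rfl

/-- The boundary of the transform. -/
theorem transform_E (δ : Decoration k m) (Φ : Fin (m + 1) → MvPowerSeries (Fin (m + 1)) k) (w : Fin (m + 1) → ℕ)
    (c : Fin (m + 1) → k) (i : Fin (m + 1)) : (δ.transform Φ w c i).E = insert 0 (newLetters δ.E Φ c i) := by
  unfold transform
  split_ifs <;> rfl

/-- The order of the transform is read on its equation. -/
theorem transform_o (δ : Decoration k m) (Φ : Fin (m + 1) → MvPowerSeries (Fin (m + 1)) k) (w : Fin (m + 1) → ℕ)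
    (c : Fin (m + 1) → k) (i : Fin (m + 1)) : (δ.transform Φ w c i).o = ((sqfRep (δ.strict Φ w c i)).order).toNat := by
  rw [Decoration.o, transform_f]

/-- The history of the transform: RESET (every boundary letter is old) when the order dropped. -/
theorem transform_O_of_lt (δ : Decoration k m) (Φ : Fin (m + 1) → MvPowerSeries (Fin (m + 1)) k) (w : Fin (m + 1) → ℕ)
    (c : Fin (m + 1) → k) (i : Fin (m + 1)) (h : ((sqfRep (δ.strict Φ w c i)).order).toNat < δ.o) :
    (δ.transform Φ w c i).O = insert 0 (newLetters δ.E Φ c i) := by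
  unfold transform
  rw [if_pos h]

/-- The history of the transform: the THROUGH-GOING OLD LETTERS when the order did not drop. -/
theorem transform_O_of_not_lt (δ : Decoration k m) (Φ : Fin (m + 1) → MvPowerSeries (Fin (m + 1)) k) (w : Fin (m + 1) → ℕ)
    (c : Fin (m + 1) → k) (i : Fin (m + 1)) (h : ¬ ((sqfRep (δ.strict Φ w c i)).order).toNat < δ.o) :
    (δ.transform Φ w c i).O = newLetters δ.O Φ c i := by
  unfold transform
  rw [if_neg h]

end Decoration

/-- THE START DECORATION of a squarefree germ: itself, with empty boundary and empty history. -/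
def Decoration.start (f : MvPowerSeries (Fin (m + 1)) k) : Decoration k m :=
  { f := f, E := ∅, O := ∅, O_subset := le_rfl }

end TameFourTupleDrop

end Summit.ResolutionOfSingularities.ResolutionOfSingularities.Theorems

end
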